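import Summits.AtomisticToContinuum.FouriersLaw.Theses.BoundaryEscapeDeficit

/-!
# `BoundaryEscapeDeficit.Assembly` — PROVED

Route `AtomisticToContinuum/FouriersLaw/BoundaryEscapeDeficit` (Fourier's law as the escape deficit of
one boundary observable), assembly item `stmt-AtomisticToContinuum-12243` (`Assembly`):

  `NessUnique → ResponseIdentity → HalfChainTailLaw → DiffusiveCrossover → EscapeNonOscillation →
   FouriersLaw`.

The route file carries the planner-authored, sorry-free D-0027 §2.1 deciding theorem
`Summit.AtomisticToContinuum.FouriersLaw.Theses.BoundaryEscapeDeficit.closes`, whose type is literally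
the body of `Assembly` (curried); this file records the item-closing theorem whose type is the route
decl `Assembly` by name.  For the mathematics — second layer: the tail law at `t = a₁N², a₀N²` plus the
diffusive crossover bracket `(N−1)·γ·E_N` between two positive reals eventually in `N`, and the `EReal`
non-oscillation limit is then real and positive (the escape law `X_b(E)`, also landed separately as
`escapeLawOfCruxes_proof`); first layer: clause (i) of `FouriersLawFor` from the in-tree existence
theorem `pinnedChain_exists_isSteadyState` plus weak-NESS uniqueness, clause (ii) with
`κ T := κ_b(T)` and `D N := limUnder` of the response quotient, identified with `(N−1)·γ·E_N` for
`N ≥ 1` by `ResponseIdentity` — see the docstring and body of `closes` in the route file.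
No named-fact hypotheses: the theorem is unconditional (its axioms are those of `closes`:
`propext`, `Classical.choice`, `Quot.sound`).
-/

namespace Summit.AtomisticToContinuum.FouriersLaw.Theorems

/-- Settles `stmt-AtomisticToContinuum-12243` (assembly of route `BoundaryEscapeDeficit`): weak
steady-state uniqueness `NessUnique`, the response identity `D_N = (N−1)·γ·E_N` (`ResponseIdentity`),
the half-line boundary tail law `HalfChainTailLaw`, the diffusive crossover `DiffusiveCrossover` and
the import slot `EscapeNonOscillation` imply the sub-problem statement `FouriersLaw`.  Proof: the
route's deciding theorem `closes` (after unfolding `Assembly`). [folklore] -/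
theorem boundaryEscapeDeficit_assembly_proof :
    Summit.AtomisticToContinuum.FouriersLaw.Theses.BoundaryEscapeDeficit.Assembly := by
  unfold Summit.AtomisticToContinuum.FouriersLaw.Theses.BoundaryEscapeDeficit.Assembly
  exact Summit.AtomisticToContinuum.FouriersLaw.Theses.BoundaryEscapeDeficit.closes

end Summit.AtomisticToContinuum.FouriersLaw.Theorems
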